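import Literature.NumberTheory.LFunctions.YoshidaWindowSpacesProofs
import Summits.RiemannHypothesis.RiemannHypothesis.Theorems.SpectralTraceWindowTraceArchStubBandlimitedTestAux
import HarnessLib

/-!
# RiemannHypothesis — a continuous band-limited kernel with zero-free nonnegative transform

Helper file (`--supports stmt-RiemannHypothesis-0098`), RH-free, standard axioms.  Seat rh-explicit
weil-3 (structure).  Used by `WeilBochnerMeasureSpectral.lean` to extend the Bochner–Kreĭn
representation of a window from hermitian squares to ALL tests of the open window.

* `exists_zeroFree_kernel`: for `0 < r ≤ 1` there is a continuous kernel `κ` with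
  `tsupport κ ⊆ [-2r, 2r]` whose transform on the critical line is a real number with
  **`r/(1+u²)² ≤ κ̂(½+iu)` and `‖κ̂(½+iu)‖ ≤ 36/(r(1+u²))`** for every real `u`.

Construction: `η(x) = eˣ (1 − |x|)₊` has `η̂(½+iu) = (e^c + e^{−c} − 2)/c²`, `c = 1 + iu`
(`weilMellin_expTent`), and `|e^c + e^{−c} − 2|² = ((e + e⁻¹) cos u − 2)² + (e − e⁻¹)² sin² u ≥ 1`,
`≤ 36`, `|c|² = 1 + u²`; so `κ₁ = η ⋆ η̃` (continuous, supported in `[-2, 2]`, transform `|η̂|²`) has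
`1/(1+u²)² ≤ κ̂₁(½+iu) ≤ 36/(1+u²)²`, and `κ(x) = κ₁(x/r)` has transform `r κ̂₁(½ + iru)`.  The point
is that `κ̂` has NO real zeros (the tent's transform `sinc²` does; the factor `eˣ` moves the zeros off
the real axis), so `κ̂` dominates `|k̂|` for every smooth test `k`.
-/

noncomputable section

set_option linter.dupNamespace false  -- the mandated namespace repeats `RiemannHypothesis`

open Complex Filter Set MeasureTheory intervalIntegral
open scoped Real Topology ComplexConjugate
open Literature.NumberTheory.LFunctions

namespace Summit.RiemannHypothesis.RiemannHypothesis.Theorems.WeilBochnerMeasure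

/-! ## The kernel `η(x) = eˣ (1 − |x|)₊` and its transform -/

/-- `η(x) = eˣ (1 − |x|)₊` is continuous. -/
theorem continuous_expTent : Continuous fun x : ℝ ↦ ((Real.exp x * max (1 - |x|) 0 : ℝ) : ℂ) :=
  continuous_ofReal.comp (Real.continuous_exp.mul ((continuous_const.sub continuous_abs).max
    continuous_const))

/-- `η` vanishes off `(-1, 1)`. -/
theorem expTent_eq_zero {x : ℝ} (hx : 1 ≤ |x|) :
    (((Real.exp x * max (1 - |x|) 0 : ℝ) : ℂ)) = 0 := by
  rw [max_eq_right (by linarith), mul_zero, Complex.ofReal_zero]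

/-- `tsupport η ⊆ [-1, 1]`. -/
theorem tsupport_expTent_subset :
    tsupport (fun x : ℝ ↦ ((Real.exp x * max (1 - |x|) 0 : ℝ) : ℂ)) ⊆ Icc (-1) 1 := by
  refine closure_minimal (fun x hx ↦ ?_) isClosed_Icc
  rw [Function.mem_support] at hx
  by_contra h
  rw [mem_Icc, not_and_or, not_le, not_le] at h
  refine hx (expTent_eq_zero ?_)
  rcases h with h | h
  · rw [abs_of_neg (by linarith)]; linarith
  · rw [abs_of_pos (by linarith)]; linarith

/-- `η` has compact support. -/
theorem hasCompactSupport_expTent :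
    HasCompactSupport fun x : ℝ ↦ ((Real.exp x * max (1 - |x|) 0 : ℝ) : ℂ) :=
  isCompact_Icc.of_isClosed_subset (isClosed_tsupport _) tsupport_expTent_subset

/-- `η` is integrable. -/
theorem integrable_expTent : Integrable fun x : ℝ ↦ ((Real.exp x * max (1 - |x|) 0 : ℝ) : ℂ) :=
  continuous_expTent.integrable_of_hasCompactSupport hasCompactSupport_expTent

/-- **The transform of `η`: `η̂(½ + iu) = (e^c + e^{−c} − 2)/c²` with `c = 1 + iu`.**
(`∫₀¹ (1−x)e^{cx} dx = (e^c − 1 − c)/c²`, `∫₋₁⁰ (1+x)e^{cx} dx = (e^{−c} − 1 + c)/c²`.) -/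
theorem weilMellin_expTent (u : ℝ) :
    weilMellin (fun x : ℝ ↦ ((Real.exp x * max (1 - |x|) 0 : ℝ) : ℂ)) (1 / 2 + u * I) =
      (cexp (1 + u * I) + cexp (-(1 + u * I)) - 2) / (1 + u * I) ^ 2 := by
  set c : ℂ := 1 + u * I with hc
  have hc0 : c ≠ 0 := by
    intro h
    have := congrArg Complex.re h
    simp [hc] at this
  -- the integrand is `(1 - |x|)₊ e^{cx}`
  set f : ℝ → ℂ := fun x ↦ ((max (1 - |x|) 0 : ℝ) : ℂ) * cexp (c * x) with hf
  have hint : ∀ x : ℝ, ((Real.exp x * max (1 - |x|) 0 : ℝ) : ℂ) *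
      cexp ((1 / 2 + u * I - 1 / 2) * x) = f x := by
    intro x
    simp only [hf, hc]
    rw [Complex.ofReal_mul, Complex.ofReal_exp, mul_assoc, mul_comm (cexp (x : ℂ)), mul_assoc,
      ← Complex.exp_add]
    congr 2
    ring
  have hfc : Continuous f := by
    simp only [hf]
    exact (continuous_ofReal.comp ((continuous_const.sub continuous_abs).max continuous_const)).mul
      (by fun_prop)
  have hfsupp : Function.support f ⊆ Ioc (-1 : ℝ) 1 := by
    intro x hx
    rw [Function.mem_support] at hx
    by_contra h
    rw [mem_Ioc, not_and_or, not_lt, not_le] at h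
    apply hx
    simp only [hf]
    rcases h with h | h
    · rw [max_eq_right (by rw [abs_of_nonpos (by linarith)]; linarith)]; simp
    · rw [max_eq_right (by rw [abs_of_pos (by linarith)]; linarith)]; simp
  unfold weilMellin
  rw [show (fun x : ℝ ↦ ((Real.exp x * max (1 - |x|) 0 : ℝ) : ℂ) *
      cexp ((1 / 2 + u * I - 1 / 2) * x)) = f from funext hint]
  rw [← intervalIntegral.integral_eq_integral_of_support_subset hfsupp]
  -- split at `0`
  have hii : ∀ a b : ℝ, IntervalIntegrable f volume a b := fun a b ↦ hfc.intervalIntegrable _ _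
  rw [← intervalIntegral.integral_add_adjacent_intervals (hii (-1) 0) (hii 0 1)]
  -- antiderivatives
  have hexp : ∀ x : ℝ, HasDerivAt (fun y : ℝ ↦ cexp (c * y)) (c * cexp (c * x)) x := by
    intro x
    have h1 : HasDerivAt (fun y : ℝ ↦ c * (y : ℂ)) (c * 1) x :=
      ((hasDerivAt_id (x : ℂ)).const_mul c).comp_ofReal
    have h2 : HasDerivAt (fun y : ℝ ↦ cexp (c * y)) (cexp (c * x) * (c * 1)) x :=
      (Complex.hasDerivAt_exp (c * x)).comp x h1
    convert h2 using 1
    ring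
  -- on `[0, 1]`: `F₊(x) = ((1 - x)/c + 1/c²) e^{cx}`
  have hFp : ∀ x : ℝ, HasDerivAt (fun y : ℝ ↦ ((1 - (y : ℂ)) / c + 1 / c ^ 2) * cexp (c * y))
      (((1 - (x : ℂ))) * cexp (c * x)) x := by
    intro x
    have h1 : HasDerivAt (fun y : ℝ ↦ (1 - (y : ℂ)) / c + 1 / c ^ 2) (-1 / c) x := by
      have h0 : HasDerivAt (fun y : ℝ ↦ (y : ℂ)) 1 x := by
        simpa using (hasDerivAt_id (x : ℂ)).comp_ofReal
      have := ((h0.const_sub 1).div_const c).add_const (1 / c ^ 2)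
      simpa [neg_div] using this
    have h := h1.mul (hexp x)
    refine h.congr_deriv ?_
    field_simp
    ring
  have hFm : ∀ x : ℝ, HasDerivAt (fun y : ℝ ↦ ((1 + (y : ℂ)) / c - 1 / c ^ 2) * cexp (c * y))
      (((1 + (x : ℂ))) * cexp (c * x)) x := by
    intro x
    have h1 : HasDerivAt (fun y : ℝ ↦ (1 + (y : ℂ)) / c - 1 / c ^ 2) (1 / c) x := by
      have h0 : HasDerivAt (fun y : ℝ ↦ (y : ℂ)) 1 x := by
        simpa using (hasDerivAt_id (x : ℂ)).comp_ofReal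
      have := ((h0.const_add 1).div_const c).sub_const (1 / c ^ 2)
      simpa using this
    have h := h1.mul (hexp x)
    refine h.congr_deriv ?_
    field_simp
    ring
  -- the two pieces
  have hpos : ∫ x in (0 : ℝ)..1, f x = cexp c / c ^ 2 - (1 / c + 1 / c ^ 2) := by
    have heq : ∀ x ∈ uIcc (0 : ℝ) 1, f x = (1 - (x : ℂ)) * cexp (c * x) := by
      intro x hx
      rw [uIcc_of_le zero_le_one, mem_Icc] at hx
      simp only [hf]
      rw [max_eq_left (by rw [abs_of_nonneg hx.1]; linarith), abs_of_nonneg hx.1]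
      push_cast; ring
    rw [intervalIntegral.integral_congr heq,
      intervalIntegral.integral_eq_sub_of_hasDerivAt (fun x _ ↦ hFp x)
        ((by fun_prop : Continuous fun x : ℝ ↦ (1 - (x : ℂ)) * cexp (c * x)).intervalIntegrable _ _)]
    push_cast
    simp only [mul_zero, mul_one, Complex.exp_zero, sub_zero]
    field_simp
    ring
  have hneg : ∫ x in (-1 : ℝ)..0, f x = (1 / c - 1 / c ^ 2) + cexp (-c) / c ^ 2 := by
    have heq : ∀ x ∈ uIcc (-1 : ℝ) 0, f x = (1 + (x : ℂ)) * cexp (c * x) := by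
      intro x hx
      rw [uIcc_of_le (by norm_num : (-1 : ℝ) ≤ 0), mem_Icc] at hx
      simp only [hf]
      rw [max_eq_left (by rw [abs_of_nonpos hx.2]; linarith), abs_of_nonpos hx.2]
      push_cast; ring
    rw [intervalIntegral.integral_congr heq,
      intervalIntegral.integral_eq_sub_of_hasDerivAt (fun x _ ↦ hFm x)
        ((by fun_prop : Continuous fun x : ℝ ↦ (1 + (x : ℂ)) * cexp (c * x)).intervalIntegrable _ _)]
    push_cast
    simp only [mul_zero, mul_neg, mul_one, Complex.exp_zero, add_zero]
    field_simp
    ring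
  rw [hneg, hpos]
  field_simp
  ring

/-- `‖e^c + e^{−c} − 2‖² ≥ 1` for `c = 1 + iu`: the transform of `η` has no real zeros
(`((e+e⁻¹) cos u − 2)² + (e−e⁻¹)² sin² u` is minimal at `cos u = 1`). -/
theorem one_le_norm_sq_expTent_numerator (u : ℝ) :
    1 ≤ ‖cexp (1 + u * I) + cexp (-(1 + u * I)) - 2‖ ^ 2 := by
  set p : ℝ := Real.exp 1 with hp
  set q : ℝ := Real.exp (-1) with hq
  have hp1 : 2.7182818283 < p := Real.exp_one_gt_d9
  have hp2 : p < 2.7182818286 := Real.exp_one_lt_d9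
  have hpq : p * q = 1 := by rw [hp, hq, ← Real.exp_add]; simp
  have hq0 : 0 < q := Real.exp_pos _
  have hq1 : q < 0.3679 := by nlinarith
  have hq2 : 0.3678 < q := by nlinarith
  have hexp1 : cexp (1 + u * I) = (p : ℂ) * (Real.cos u + Real.sin u * I) := by
    rw [Complex.exp_add, Complex.exp_mul_I, hp, Complex.ofReal_exp, ← Complex.ofReal_cos,
      ← Complex.ofReal_sin]
    push_cast
    ring
  have hexp2 : cexp (-(1 + u * I)) = (q : ℂ) * (Real.cos u - Real.sin u * I) := by
    rw [show -(1 + (u : ℂ) * I) = ((-1 : ℝ) : ℂ) + ((-u : ℝ) : ℂ) * I by push_cast; ring,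
      Complex.exp_add, Complex.exp_mul_I, hq, Complex.ofReal_exp, ← Complex.ofReal_cos,
      ← Complex.ofReal_sin, Real.cos_neg, Real.sin_neg]
    push_cast
    ring
  have hre : (cexp (1 + u * I) + cexp (-(1 + u * I)) - 2).re = (p + q) * Real.cos u - 2 := by
    rw [hexp1, hexp2]
    simp only [Complex.sub_re, Complex.add_re, Complex.mul_re, Complex.ofReal_re, Complex.ofReal_im,
      Complex.add_im, Complex.sub_im, Complex.mul_im, Complex.I_re, Complex.I_im, Complex.re_ofNat,
      mul_zero, mul_one, zero_mul, sub_zero, add_zero, zero_sub, zero_add]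
    ring
  have him : (cexp (1 + u * I) + cexp (-(1 + u * I)) - 2).im = (p - q) * Real.sin u := by
    rw [hexp1, hexp2]
    simp only [Complex.sub_im, Complex.add_im, Complex.mul_im, Complex.ofReal_re, Complex.ofReal_im,
      Complex.add_re, Complex.sub_re, Complex.mul_re, Complex.I_re, Complex.I_im, Complex.im_ofNat,
      mul_zero, mul_one, zero_mul, sub_zero, add_zero, zero_add]
    ring
  rw [← Complex.normSq_eq_norm_sq, Complex.normSq_apply, hre, him]
  set C := Real.cos u with hC
  set S := Real.sin u with hS
  have hcs : C ^ 2 + S ^ 2 = 1 := Real.cos_sq_add_sin_sq u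
  have hc1 : C ≤ 1 := Real.cos_le_one u
  have key : ((p + q) * C - 2) * ((p + q) * C - 2) + (p - q) * S * ((p - q) * S) =
      4 * C ^ 2 - 4 * (p + q) * C + 4 + (p - q) ^ 2 := by
    linear_combination (4 * C ^ 2) * hpq + (p - q) ^ 2 * hcs
  rw [key]
  have hd : 2.35 ≤ p - q := by linarith
  have hd2 : 5.5225 ≤ (p - q) ^ 2 := by nlinarith
  have hs : p + q ≤ 3.0865 := by linarith
  have hprod : 0 ≤ (1 - C) * (p + q - 1 - C) := mul_nonneg (by linarith) (by linarith)
  nlinarith [hprod]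

/-- `‖e^c + e^{−c} − 2‖ ≤ 6` for `c = 1 + iu`. -/
theorem norm_expTent_numerator_le (u : ℝ) :
    ‖cexp (1 + u * I) + cexp (-(1 + u * I)) - 2‖ ≤ 6 := by
  have h1 : ‖cexp (1 + u * I)‖ ≤ 3 := by
    rw [Complex.norm_exp]
    simp only [Complex.add_re, Complex.one_re, Complex.mul_re, Complex.ofReal_re, Complex.I_re,
      mul_zero, Complex.ofReal_im, Complex.I_im, mul_one, sub_self, add_zero]
    have := Real.exp_one_lt_d9; linarith
  have h2 : ‖cexp (-(1 + u * I))‖ ≤ 1 := by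
    rw [Complex.norm_exp]
    simp only [Complex.neg_re, Complex.add_re, Complex.one_re, Complex.mul_re, Complex.ofReal_re,
      Complex.I_re, mul_zero, Complex.ofReal_im, Complex.I_im, mul_one, sub_self, add_zero]
    rw [Real.exp_le_one_iff]; norm_num
  calc ‖cexp (1 + u * I) + cexp (-(1 + u * I)) - 2‖
      ≤ ‖cexp (1 + u * I)‖ + ‖cexp (-(1 + u * I))‖ + ‖(2 : ℂ)‖ := by
        refine (norm_sub_le _ _).trans ?_
        gcongr
        exact norm_add_le _ _
    _ ≤ 3 + 1 + 2 := by
        gcongr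
        simp
    _ = 6 := by norm_num

/-- `‖1 + iu‖² = 1 + u²`. -/
theorem norm_sq_one_add_mul_I (u : ℝ) : ‖(1 : ℂ) + u * I‖ ^ 2 = 1 + u ^ 2 := by
  rw [← Complex.normSq_eq_norm_sq, Complex.normSq_apply]
  simp
  ring

/-- **Two-sided bound for `|η̂(½+iu)|²`: `1/(1+u²)² ≤ ‖η̂(½+iu)‖² ≤ 36/(1+u²)²`.** -/
theorem norm_sq_weilMellin_expTent_bounds (u : ℝ) :
    1 / (1 + u ^ 2) ^ 2 ≤
        ‖weilMellin (fun x : ℝ ↦ ((Real.exp x * max (1 - |x|) 0 : ℝ) : ℂ)) (1 / 2 + u * I)‖ ^ 2 ∧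
      ‖weilMellin (fun x : ℝ ↦ ((Real.exp x * max (1 - |x|) 0 : ℝ) : ℂ)) (1 / 2 + u * I)‖ ^ 2 ≤
        36 / (1 + u ^ 2) ^ 2 := by
  rw [weilMellin_expTent, norm_div, norm_pow, div_pow]
  rw [show (‖(1 : ℂ) + u * I‖ ^ 2) ^ 2 = (1 + u ^ 2) ^ 2 by rw [norm_sq_one_add_mul_I]]
  have h1 := one_le_norm_sq_expTent_numerator u
  have h2 := norm_expTent_numerator_le u
  have h3 : ‖cexp (1 + u * I) + cexp (-(1 + u * I)) - 2‖ ^ 2 ≤ 36 := by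
    nlinarith [norm_nonneg (cexp (1 + u * I) + cexp (-(1 + u * I)) - 2)]
  have hpos : 0 < (1 + u ^ 2) ^ (2 : ℕ) := by positivity
  exact ⟨div_le_div_of_nonneg_right h1 hpos.le, div_le_div_of_nonneg_right h3 hpos.le⟩

/-! ## The zero-free kernel -/

/-- **A continuous band-limited kernel with zero-free nonnegative transform.**  For `0 < r ≤ 1` there is
a continuous `κ` with `tsupport κ ⊆ [-2r, 2r]` whose transform on the critical line is real with
`r/(1+u²)² ≤ κ̂(½+iu)` and `‖κ̂(½+iu)‖ ≤ 36/(r(1+u²))` (`κ(x) = (η ⋆ η̃)(x/r)`). -/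
theorem exists_zeroFree_kernel {r : ℝ} (hr : 0 < r) (hr1 : r ≤ 1) :
    ∃ κ : ℝ → ℂ, Continuous κ ∧ tsupport κ ⊆ Icc (-(2 * r)) (2 * r) ∧
      ∀ u : ℝ, (weilMellin κ (1 / 2 + u * I)).im = 0 ∧
        r / (1 + u ^ 2) ^ 2 ≤ (weilMellin κ (1 / 2 + u * I)).re ∧
        ‖weilMellin κ (1 / 2 + u * I)‖ ≤ 36 / (r * (1 + u ^ 2)) := by
  set η : ℝ → ℂ := fun x : ℝ ↦ ((Real.exp x * max (1 - |x|) 0 : ℝ) : ℂ) with hη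
  set κ₁ : ℝ → ℂ := weilConv η (weilReflect η) with hκ₁
  -- `κ₁` is continuous, supported in `[-2, 2]`, with transform `|η̂|²`
  have hκ₁c : Continuous κ₁ := by
    simp only [hκ₁, weilConv]
    exact (hasCompactSupport_expTent.comp_homeomorph (Homeomorph.neg ℝ) |>.comp_left
      (by simp : (starRingEnd ℂ) 0 = 0)).continuous_convolution_right
      (ContinuousLinearMap.mul ℂ ℂ) continuous_expTent.locallyIntegrable
      (Complex.continuous_conj.comp (continuous_expTent.comp continuous_neg))
  have hκ₁s : tsupport κ₁ ⊆ Icc (-(2 * 1)) (2 * 1) :=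
    tsupport_weilConv_weilReflect_subset hasCompactSupport_expTent tsupport_expTent_subset
  have hκ₁line : ∀ u : ℝ, weilMellin κ₁ (1 / 2 + u * I) =
      ((‖weilMellin η (1 / 2 + u * I)‖ ^ 2 : ℝ) : ℂ) := fun u ↦
    Yoshida1992.weilMellin_weilConv_weilReflect_half_of_integrable integrable_expTent u
  -- the dilate
  set κ : ℝ → ℂ := fun x ↦ κ₁ (r⁻¹ * x) with hκ
  have hri : 0 < r⁻¹ := inv_pos.2 hr
  refine ⟨κ, hκ₁c.comp (continuous_const.mul continuous_id), ?_, fun u ↦ ?_⟩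
  · refine closure_minimal (fun x hx ↦ ?_) isClosed_Icc
    rw [Function.mem_support] at hx
    have h1 : r⁻¹ * x ∈ tsupport κ₁ := subset_tsupport _ (Function.mem_support.2 hx)
    have h2 := hκ₁s h1
    simp only [mem_Icc, mul_one] at h2 ⊢
    rw [← div_eq_inv_mul, le_div_iff₀ hr, div_le_iff₀ hr] at h2
    constructor <;> nlinarith [h2.1, h2.2]
  · have hdil := SpectralTraceWindowTraceArch.stub_bandlimitedTest_weilMellin_dilate κ₁ hri
      (1 / 2 + u * I)
    have e1 : (1 : ℂ) / 2 + (1 / 2 + u * I - 1 / 2) / ((r⁻¹ : ℝ) : ℂ) = 1 / 2 + ((r * u : ℝ) : ℂ) * I := by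
      have hr' : (r : ℂ) ≠ 0 := by exact_mod_cast hr.ne'
      push_cast
      field_simp
      ring
    have e2 : (((r⁻¹ : ℝ) : ℂ))⁻¹ = (r : ℂ) := by push_cast; rw [inv_inv]
    have hκline : weilMellin κ (1 / 2 + u * I) =
        ((r * ‖weilMellin η (1 / 2 + (r * u : ℝ) * I)‖ ^ 2 : ℝ) : ℂ) := by
      simp only [hκ]
      rw [hdil, e1, e2, hκ₁line (r * u)]
      push_cast; ring
    obtain ⟨hlo, hhi⟩ := norm_sq_weilMellin_expTent_bounds (r * u)
    have hr2 : r ^ 2 ≤ 1 := by nlinarith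
    have hru : (1 + (r * u) ^ 2) ≤ 1 + u ^ 2 := by
      have h := mul_le_mul_of_nonneg_right hr2 (sq_nonneg u)
      nlinarith [h]
    have hru' : r ^ 2 * (1 + u ^ 2) ≤ 1 + (r * u) ^ 2 := by nlinarith [hr2]
    have hpos1 : 0 < 1 + (r * u) ^ 2 := by positivity
    rw [hκline, Complex.ofReal_im, Complex.ofReal_re, Complex.norm_real, Real.norm_eq_abs,
      abs_of_nonneg (by positivity)]
    refine ⟨rfl, ?_, ?_⟩
    · calc r / (1 + u ^ 2) ^ 2 ≤ r / (1 + (r * u) ^ 2) ^ 2 := by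
            gcongr
        _ = r * (1 / (1 + (r * u) ^ 2) ^ 2) := by ring
        _ ≤ r * ‖weilMellin η (1 / 2 + (r * u : ℝ) * I)‖ ^ 2 :=
            mul_le_mul_of_nonneg_left hlo hr.le
    · calc r * ‖weilMellin η (1 / 2 + (r * u : ℝ) * I)‖ ^ 2 ≤ r * (36 / (1 + (r * u) ^ 2) ^ 2) :=
            mul_le_mul_of_nonneg_left hhi hr.le
        _ ≤ r * (36 / (1 + (r * u) ^ 2)) := by
            refine mul_le_mul_of_nonneg_left ?_ hr.le
            rw [div_le_div_iff₀ (by positivity) hpos1]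
            nlinarith
        _ ≤ 36 / (r * (1 + u ^ 2)) := by
            rw [mul_div_assoc', div_le_div_iff₀ hpos1 (by positivity)]
            nlinarith [mul_pos hr hpos1]

end Summit.RiemannHypothesis.RiemannHypothesis.Theorems.WeilBochnerMeasure

end
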